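import Summits.ResolutionOfSingularities.ResolutionOfSingularities.Theorems.FrobeniusLadderFRationalResolutionClassOneFourthOneThree
import Mathlib.Data.ZMod.Basic
import HarnessLib

/-!
# Crux `FrobeniusLadder.FRationalResolution` (stmt-ResolutionOfSingularities-15317), line `redirect`,
# stub `stub_diagonalizableQuotientResolution` — THE SURFACE CLASSES `1/3(1,2)` AND `1/4(1,3)` FOR HONEST `ℤ/r`-GRADED CHARTS

`…ClassOneThirdOneTwo.hasResolution_of_isolated_fixedPoints_oneThird` (p843993) and
`…ClassOneFourthOneThree.hasResolution_of_isolated_fixedPoints_oneFourth` (p844032) take, besides the fixed-point datum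
`m ∈ P ↔ Σ mᵢ • aᵢ = 0`, the arithmetic description `m ∈ P ↔ r ∣ m₀ + (r−1) m₁` of the weight kernel. For a chart graded by
`A = ZMod r` with weights `a = (1, r − 1)` the second follows from the first; this file records the bridge and the two class theorems
with the single, honest hypothesis.

* `weight_fin_two` — `Σ mᵢ • aᵢ = m₀ • a₀ + m₁ • a₁`;
* `weight_zmod_eq_zero_iff` — for `a = (1, c) : Fin 2 → ZMod r`: `Σ mᵢ • aᵢ = 0 ↔ r ∣ m₀ + c m₁`;
* ★★★★ `hasResolution_of_isolated_fixedPoints_zmod3` (`A = ℤ/3`, `a = (1,2)`), ★★★★ `hasResolution_of_isolated_fixedPoints_zmod4`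
  (`A = ℤ/4`, `a = (1,3)`).

Honest label: TOY surface instances of the class pipeline; no stub, crux or summit closed. No definitions, no named facts, no sorry.
[folklore; cite: CoxLittleSchenck2011, §10.1] [cite: Kato1994, Thm. (3.2)]
-/

noncomputable section

-- single-problem summit: the doubled namespace component is forced
set_option linter.dupNamespace false

open CategoryTheory AlgebraicGeometry TopologicalSpace IsLocalRing
open Literature.AlgebraicGeometry.Resolution

namespace Summit.ResolutionOfSingularities.ResolutionOfSingularities.Theorems.FRationalResolution.ClassZModWeights

/-- `Σ mᵢ • aᵢ` on `Fin 2`. [folklore] -/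
theorem weight_fin_two {A : Type} [AddCommMonoid A] (a : Fin 2 → A) (m : Fin 2 →₀ ℕ) :
    Finsupp.weight a m = m 0 • a 0 + m 1 • a 1 := by
  rw [WeightKernelBasis.weight_eq_sum, Fin.sum_univ_two]

/-- **The weight kernel of `a = (1, c)` in `ℤ/r`**: `m₀ • 1 + m₁ • c = 0 ↔ r ∣ m₀ + c m₁`. [folklore] -/
theorem weight_zmod_eq_zero_iff (r c : ℕ) (m : Fin 2 →₀ ℕ) :
    Finsupp.weight (![(1 : ZMod r), (c : ZMod r)]) m = 0 ↔ r ∣ m 0 + c * m 1 := by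
  rw [weight_fin_two, ← ZMod.natCast_eq_zero_iff]
  simp only [Matrix.cons_val_zero, Matrix.cons_val_one, nsmul_eq_mul, mul_one, Nat.cast_add,
    Nat.cast_mul]
  constructor <;> intro h <;> simpa [mul_comm] using h

/-- ★★★★ **`A = ℤ/3`, weights `(1,2)`: resolution of varieties whose singular points are isolated fixed points of type `1/3(1,2)`.**
[folklore; cite: CoxLittleSchenck2011, §10.1] [cite: Kato1994, Thm. (3.2)] -/
theorem hasResolution_of_isolated_fixedPoints_zmod3 (k : Type) [Field k] (X : Scheme.{0}) [IsIntegral X]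
    (f : X ⟶ Spec (.of k)) [LocallyOfFiniteType f] (hfin : (Scheme.regularLocus X)ᶜ.Finite)
    (hchart : ∀ t : X, t ∉ Scheme.regularLocus X →
      ∃ (k' : Type) (_ : Field k')
        (S : Type) (_ : CommRing S) (_ : Algebra k' S) (𝒮 : ZMod 3 → Submodule k' S) (_ : GradedAlgebra 𝒮)
        (_ : Algebra.FiniteType k' S) (φ : Spec (.of (𝒮 0)) ⟶ X) (_ : Etale φ)
        (𝔔 : Ideal S) (_ : 𝔔.IsPrime) (_ : ∀ a : ZMod 3, a ≠ 0 → ∀ s ∈ 𝒮 a, s ∈ 𝔔)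
        (x : Fin 2 → S) (P : AddSubmonoid (Fin 2 →₀ ℕ))
        (_ : ∀ i, x i ∈ 𝔔 ∧ x i ∈ 𝒮 (![(1 : ZMod 3), ((2 : ℕ) : ZMod 3)] i))
        (_ : Ideal.span (algebraMap S (Localization.AtPrime 𝔔) '' Set.range x) = maximalIdeal (Localization.AtPrime 𝔔))
        (_ : ((2 : ℕ) : WithBot ℕ∞) = ringKrullDim (Localization.AtPrime 𝔔))
        (_ : ∀ m, m ∈ P ↔ Finsupp.weight (![(1 : ZMod 3), ((2 : ℕ) : ZMod 3)]) m = 0),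
        φ ⟨𝔔.comap (algebraMap (𝒮 0) S), inferInstance⟩ = t) :
    Scheme.HasResolution X := by
  refine ClassOneThirdOneTwo.hasResolution_of_isolated_fixedPoints_oneThird k X f hfin fun t ht => ?_
  have hc := hchart t ht
  obtain ⟨k', ik, S, iS₁, iS₂, 𝒮, i𝒮, iS₃, φ, iφ, 𝔔, i𝔔, hfix, x, P, hxa, hspan, hn, hP, hφt⟩ := hc
  haveI : Fact (1 < 3) := ⟨by norm_num⟩
  exact ⟨k', ik, ZMod 3, inferInstance, inferInstance, is_add_torsion_of_finite (G := ZMod 3), S, iS₁, iS₂, 𝒮, i𝒮, iS₃, φ, iφ,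
    𝔔, i𝔔, hfix, x, ![(1 : ZMod 3), ((2 : ℕ) : ZMod 3)], P, hxa, hspan, hn, hP,
    fun m => (hP m).trans (weight_zmod_eq_zero_iff 3 2 m), hφt⟩

/-- ★★★★ **`A = ℤ/4`, weights `(1,3)`: resolution of varieties whose singular points are isolated fixed points of type `1/4(1,3)`.**
[folklore; cite: CoxLittleSchenck2011, §10.1] [cite: Kato1994, Thm. (3.2)] -/
theorem hasResolution_of_isolated_fixedPoints_zmod4 (k : Type) [Field k] (X : Scheme.{0}) [IsIntegral X]
    (f : X ⟶ Spec (.of k)) [LocallyOfFiniteType f] (hfin : (Scheme.regularLocus X)ᶜ.Finite)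
    (hchart : ∀ t : X, t ∉ Scheme.regularLocus X →
      ∃ (k' : Type) (_ : Field k')
        (S : Type) (_ : CommRing S) (_ : Algebra k' S) (𝒮 : ZMod 4 → Submodule k' S) (_ : GradedAlgebra 𝒮)
        (_ : Algebra.FiniteType k' S) (φ : Spec (.of (𝒮 0)) ⟶ X) (_ : Etale φ)
        (𝔔 : Ideal S) (_ : 𝔔.IsPrime) (_ : ∀ a : ZMod 4, a ≠ 0 → ∀ s ∈ 𝒮 a, s ∈ 𝔔)
        (x : Fin 2 → S) (P : AddSubmonoid (Fin 2 →₀ ℕ))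
        (_ : ∀ i, x i ∈ 𝔔 ∧ x i ∈ 𝒮 (![(1 : ZMod 4), ((3 : ℕ) : ZMod 4)] i))
        (_ : Ideal.span (algebraMap S (Localization.AtPrime 𝔔) '' Set.range x) = maximalIdeal (Localization.AtPrime 𝔔))
        (_ : ((2 : ℕ) : WithBot ℕ∞) = ringKrullDim (Localization.AtPrime 𝔔))
        (_ : ∀ m, m ∈ P ↔ Finsupp.weight (![(1 : ZMod 4), ((3 : ℕ) : ZMod 4)]) m = 0),
        φ ⟨𝔔.comap (algebraMap (𝒮 0) S), inferInstance⟩ = t) :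
    Scheme.HasResolution X := by
  refine ClassOneFourthOneThree.hasResolution_of_isolated_fixedPoints_oneFourth k X f hfin fun t ht => ?_
  have hc := hchart t ht
  obtain ⟨k', ik, S, iS₁, iS₂, 𝒮, i𝒮, iS₃, φ, iφ, 𝔔, i𝔔, hfix, x, P, hxa, hspan, hn, hP, hφt⟩ := hc
  haveI : Fact (1 < 4) := ⟨by norm_num⟩
  exact ⟨k', ik, ZMod 4, inferInstance, inferInstance, is_add_torsion_of_finite (G := ZMod 4), S, iS₁, iS₂, 𝒮, i𝒮, iS₃, φ, iφ,
    𝔔, i𝔔, hfix, x, ![(1 : ZMod 4), ((3 : ℕ) : ZMod 4)], P, hxa, hspan, hn, hP,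
    fun m => (hP m).trans (weight_zmod_eq_zero_iff 4 3 m), hφt⟩

end Summit.ResolutionOfSingularities.ResolutionOfSingularities.Theorems.FRationalResolution.ClassZModWeights

end
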